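import Summits.QuantumFields.YangMills.Theorems.UnitScaleTiltProp7QTwSCentralTowerRows
import HarnessLib

/-!
# Route `UnitScaleTilt`, crux K1 child «MinimiserStabilityRegPr» (stmt-QuantumFields-19200), skeleton v10, stub `stub_existenceMinimalOrbit` (EX), route (α) —
# **(R2t′) THE TOWER CLOSENESS IS GEOMETRIC IN THE LEVEL**: for `U₀ ∈ 𝔘_k(ε₀)`, `‖A(b)‖ ≤ e·η`, `10⁹L²e ≤ 1`, `10¹²L³ε₀ ≤ 1` and every `j ≤ K − n`, the perturbed covariant tower is
# bondwise relatively close to the background tower by **`3(2e + 2700Lε₀)·L^{j}η = 3(2e + 2700Lε₀)·L^{j−(K−n)}`** — the landed UNIFORM row ✓`Prop7SymAvgTwSym.norm_dbarCovIterU_rel_sub_one_le_of_regPr`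
# threw the factor `L^{j}η ≤ 1` away by monotonicity; the engine ✓`Prop7SymFrameRelCluster.norm_dbarCovIterU_rel_frameAccU_le_of_plaqSmall` carries it (`L^j·(2ηe + 30ℓ·sB_j)`,
# `sB_j ≤ 18L^j·ε₀η²`).  This is the located CRITICAL INPUT of the (P2-core) plan v2 (LOCATE memo `pub/ym3-torus/ym-ust-20520-w5/g7/LOCATE-P2-MARGIN-w5g7.md` v1.1 §(d)): summed over the
# `k = K − n → ∞` levels, `Σ_j 3(2e + 2700Lε₀)L^{j−k} ≤ 3(2e + 2700Lε₀)·L∕(L − 1)` stays L-only, whereas the uniform row summed gives `k·3(2e + 2700Lε₀) → ∞`.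

Cell `ym3-torus`, width seat `ym-ust-20520-w5` (gen 7).  THEOREMS ONLY (0 `def`, 0 `sorry`).  `--supports stmt-QuantumFields-19200 --as helper`, count-neutral.  YM₃ on T³ is a
ladder rung (R3), not the Clay problem; nothing here claims the stub, the crux, d = 4 or the mass gap.

WHAT IS PROVED (sorry-free, no definition; ns `…Theorems.Prop7SymAvgTwSym`, beside the uniform row):
* `regThreshold_eq_mul_eta_sq` — `a₀ = ε₀·η²` (the (2) threshold in `η`-letters); `pow_mul_eta_le_one` — `L^j·η ≤ 1` for `j ≤ K − n`.
* ★★★`norm_dbarCovIterU_rel_sub_one_le_geom_of_regPr` — the displayed bound `≤ 3(2e + 2700Lε₀)·((L:ℝ)^j·η)`; also the two FRAME bounds of the engine in the same letters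
  (`‖frameAccU j … − 1‖ ≤ 30L·(2e + 2700Lε₀)·(L^j η)` at both ends of the bond).
* ★★`norm_tstairU_sub_one_le_geom_of_regPr` — the STAIR letter `τ_j` of T5-B inherits the factor: `‖τ_j(y,i) − 1‖ ≤ 60L·(2e + 2700Lε₀)·(L^j·η)` (✓`norm_tstairU_sub_one_le_of_rel`).
HONEST SCOPE.  A re-wrap of the landed engine with the level kept; the LOOP letters `H_j` (✓`Prop7TowerClosenessOfRegPr.norm_loopH_sub_one_le_of_regPr`) inherit the factor the same way
(their plaquette input ✓`plaqSmall_iter_T3_allL` is already geometric) — that re-wrap is the sequel; nothing of print is asserted.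

References: T. Bałaban, CMP 98 (1985) 17–51 [Balaban1985Averaging] ((161)–(163) p.42, p.44); CMP 102 (1985) 277–309 [Balaban1985Variational] ((2) p.278); CMP 109 (1987) 249–301
[Balaban1987RG1] ((0.3)–(0.4) pp.252–253).
-/

set_option autoImplicit false

noncomputable section

open scoped Matrix.Norms.L2Operator
open Filter Topology Metric

namespace Summit.QuantumFields.YangMills.Theorems.Prop7SymAvgTwSym

open NormedSpace
open Literature.MathematicalPhysics.QuantumFieldTheory.Balaban1983to89
open T4Continuum BlockAveraging AveragingRT ExpMeanLog MatrixLog BlockAveragingEMLLinearised LatticeFieldCalculus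
open B10Eq27TorusAxialLog (holT unitsField toUField)
open B7Prop1Explicit (expUnit U1 mem_U1)
open T3ContinuumYM3Torus
open T3RegularMinimiser (regThreshold)
open T3PrintedRegularMinimiser (RegPr)
open T3SectALandauChart (eta eta_pos bgUnits)
open Summit.QuantumFields.YangMills.Theorems.Prop8Chart (loopHolU emlIterU expCfg)
open Summit.QuantumFields.YangMills.Theorems.Prop7SymAvgGLSmallOfRegPr (bgUnits_eq)
open Summit.QuantumFields.YangMills.Theorems.Prop7SymAvgRelativeBound (perturbedField_eq budget_T3)
open Summit.QuantumFields.YangMills.Theorems.Prop7DbarTwWindow (norm_smul_eta_inv_le)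
open Summit.QuantumFields.YangMills.Theorems.Prop7DbarTwSymWindow (budget_T3_frames windows_of_numerals hstep_T3 hframe_T3)
open Summit.QuantumFields.YangMills.Theorems.Prop7SymFrameRelCluster (norm_dbarCovIterU_rel_frameAccU_le_of_plaqSmall)

section T3

variable (F : T3Family) {n K : ℕ}

/-- `η = L^{−(K−n)}`: `L^{K−n}·η = 1`. [cite: Balaban1985Variational, (2) p.278] -/
theorem pow_mul_eta_eq_one : (F.L : ℝ) ^ (K - n) * eta F n K = 1 := by
  have hL0 : (0 : ℝ) < F.L := by have := F.hL.2; exact_mod_cast (show 0 < F.L by omega)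
  show (F.L : ℝ) ^ (K - n) * ((F.L : ℝ)⁻¹) ^ (K - n) = 1
  rw [← mul_pow, mul_inv_cancel₀ hL0.ne', one_pow]

/-- `L^j·η ≤ 1` for `j ≤ K − n`. [cite: Balaban1985Variational, (2) p.278] -/
theorem pow_mul_eta_le_one {j : ℕ} (hj : j ≤ K - n) : (F.L : ℝ) ^ j * eta F n K ≤ 1 := by
  have hL1 : (1 : ℝ) ≤ F.L := by have := F.hL.2; exact_mod_cast (show 1 ≤ F.L by omega)
  have hη : 0 < eta F n K := eta_pos F n K
  calc (F.L : ℝ) ^ j * eta F n K ≤ (F.L : ℝ) ^ (K - n) * eta F n K := mul_le_mul_of_nonneg_right (pow_le_pow_right₀ hL1 hj) hη.le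
    _ = 1 := pow_mul_eta_eq_one F

/-- The regularity threshold in `η`-letters: `regThreshold F n K ε₀ = ε₀·η²`. [cite: Balaban1985Variational, (2) p.278] -/
theorem regThreshold_eq_mul_eta_sq (ε₀ : ℝ) : regThreshold F n K ε₀ = ε₀ * eta F n K ^ 2 := by
  unfold regThreshold
  show ε₀ * ((F.L : ℝ)⁻¹) ^ (2 * (K - n)) = ε₀ * (((F.L : ℝ)⁻¹) ^ (K - n)) ^ 2
  rw [← pow_mul, mul_comm (K - n) 2]

set_option maxHeartbeats 400000 in
/-- ★★★ **(R2t′) THE PERTURBED COVARIANT TOWER IS RELATIVELY CLOSE TO THE BACKGROUND TOWER, GEOMETRICALLY IN THE LEVEL**: for `U₀ ∈ 𝔘_k(ε₀)`, `‖A(b)‖ ≤ e·η`, `10⁹L²e ≤ 1`,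
`10¹²L³ε₀ ≤ 1` and every `j ≤ K − n`: `‖U̿^{(j)}[e^{A}U₀♭](e′)·Ū^{(j)}[U₀♭](e′)⁻¹ − 1‖ ≤ 3(2e + 2700Lε₀)·(L^j·η)`, and the accumulated frames at both ends of `e′` are within
`6·(5L)·(2e + 2700Lε₀)·(L^j·η)` of `1` — the engine ✓`norm_dbarCovIterU_rel_frameAccU_le_of_plaqSmall` at `k := j` with W1's one-step rows ✓`hstep_T3`∕✓`hframe_T3` and W2's budgets
(✓`budget_T3_frames`, ✓`windows_of_numerals`), its conclusion `3·L^j(2ηe + 30ℓ·sB_j)` read with `sB_j ≤ 18L^j·ε₀η²`, `ℓ = 5L`, `L^jη ≤ 1`. [cite: Balaban1985Averaging, (161)-(163) p.42, p.44; Balaban1985Variational, (2) p.278] -/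
theorem norm_dbarCovIterU_rel_sub_one_le_geom_of_regPr {ε₀ e : ℝ} (hε₀ : 0 < ε₀) (he : 0 ≤ e) (hWe : 10 ^ 9 * (F.L : ℝ) ^ 2 * e ≤ 1) (hWε : 10 ^ 12 * (F.L : ℝ) ^ 3 * ε₀ ≤ 1)
    (U₀ : GaugeField (F.P K) 0 (Matrix.specialUnitaryGroup (Fin 2) ℂ)) (hreg : RegPr F n K ε₀ U₀)
    (A : PBond (F.P K) 0 → Matrix (Fin 2) (Fin 2) ℂ) (hA : ∀ b, ‖A b‖ ≤ e * eta F n K) {j : ℕ} (hj : j ≤ K - n) (e' : PBond (F.P K) j) :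
    ‖((dbarCovIterU j (bgUnits F K U₀) (fun b => expUnit (A b) * bgUnits F K U₀ b) e' : (Matrix (Fin 2) (Fin 2) ℂ)ˣ) : Matrix (Fin 2) (Fin 2) ℂ) *
          (((emlIterU j (bgUnits F K U₀) e')⁻¹ : (Matrix (Fin 2) (Fin 2) ℂ)ˣ) : Matrix (Fin 2) (Fin 2) ℂ) - 1‖ ≤
        3 * (2 * e + 2700 * (F.L : ℝ) * ε₀) * ((F.L : ℝ) ^ j * eta F n K) ∧
      ‖((frameAccU j (bgUnits F K U₀) (fun b => expUnit (A b) * bgUnits F K U₀ b) e'.src : (Matrix (Fin 2) (Fin 2) ℂ)ˣ) : Matrix (Fin 2) (Fin 2) ℂ) - 1‖ ≤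
        6 * (5 * (F.L : ℝ)) * ((2 * e + 2700 * (F.L : ℝ) * ε₀) * ((F.L : ℝ) ^ j * eta F n K)) ∧
      ‖((frameAccU j (bgUnits F K U₀) (fun b => expUnit (A b) * bgUnits F K U₀ b) e'.tgt : (Matrix (Fin 2) (Fin 2) ℂ)ˣ) : Matrix (Fin 2) (Fin 2) ℂ) - 1‖ ≤
        6 * (5 * (F.L : ℝ)) * ((2 * e + 2700 * (F.L : ℝ) * ε₀) * ((F.L : ℝ) ^ j * eta F n K)) := by
  obtain ⟨hWF, hε, he6⟩ := windows_of_numerals F hε₀.le he hWe hWε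
  have hd : (F.P K).d = 3 := T3Family.P_d F K
  have hLL : ((F.P K).L : ℝ) = F.L := rfl
  have hL3 : 3 ≤ F.L := by obtain ⟨a, ha⟩ := F.hL.1; have := F.hL.2; omega
  have hL0 : (0 : ℝ) < F.L := by exact_mod_cast (show 0 < F.L by omega)
  have hL1 : (1 : ℝ) ≤ ((F.P K).L : ℝ) := by rw [hLL]; exact_mod_cast (show 1 ≤ F.L by omega)
  have hk1 : j + 1 ≤ (F.P K).m + (F.P K).K := by
    show j + 1 ≤ F.m + K; have := F.hm; omega
  have hℓ : ((((F.P K).d + 2) * (F.P K).L : ℕ) : ℝ) = 5 * (F.L : ℝ) := by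
    rw [hd, ← hLL]; push_cast; ring
  obtain ⟨hsB0, hxX, hbud₀⟩ := budget_T3_frames F (n := n) (K := K) e hε₀ hε
  set η : ℝ := ((F.L : ℝ)⁻¹) ^ (K - n) with hη
  have hη0 : 0 < η := by positivity
  have hηne : η ≠ 0 := hη0.ne'
  have hηeta : eta F n K = η := rfl
  set a₀ : ℝ := regThreshold F n K ε₀ with ha₀
  have ha₀0 : 0 < a₀ := by rw [ha₀]; unfold regThreshold; positivity
  have ha₀η : a₀ = ε₀ * η ^ 2 := by rw [ha₀, regThreshold_eq_mul_eta_sq, hηeta]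
  have hXa : (F.L : ℝ) ^ (K - n) * ((F.L : ℝ) ^ (K - n) * a₀) = ε₀ := by
    have h1 : (F.L : ℝ) ^ (K - n) * η = 1 := by rw [← hηeta]; exact pow_mul_eta_eq_one F
    rw [ha₀η]
    calc (F.L : ℝ) ^ (K - n) * ((F.L : ℝ) ^ (K - n) * (ε₀ * η ^ 2)) = ((F.L : ℝ) ^ (K - n) * η) * ((F.L : ℝ) ^ (K - n) * η) * ε₀ := by ring
      _ = ε₀ := by rw [h1, one_mul, one_mul]
  have hU := hreg.1
  obtain ⟨ht1, -, -, -⟩ := budget_T3 F (K - n) hε₀ hε he he6 ha₀0.le hXa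
  -- the level-`j` budgets from the level-`(K − n)` ones (monotonicity in `j`), as in the uniform row
  set ℓr : ℝ := ((((F.P K).d + 2) * (F.P K).L : ℕ) : ℝ) with hℓr
  have hℓ0 : 0 ≤ ℓr := Nat.cast_nonneg _
  have hpow : ((F.P K).L : ℝ) ^ j ≤ ((F.P K).L : ℝ) ^ (K - n) := pow_le_pow_right₀ hL1 hj
  have hpow0 : 0 ≤ ((F.P K).L : ℝ) ^ j := by positivity
  have hd0 : 0 ≤ ((F.P K).d : ℝ) := Nat.cast_nonneg _
  set sBj : ℝ := 2 * (((F.P K).d : ℝ) * (3 * ((F.P K).L : ℝ) ^ j - 1)) * a₀ with hsBj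
  set sBk : ℝ := 2 * (((F.P K).d : ℝ) * (3 * ((F.P K).L : ℝ) ^ (K - n) - 1)) * a₀ with hsBk
  have h3j : 0 ≤ 3 * ((F.P K).L : ℝ) ^ j - 1 := by linarith [one_le_pow₀ (n := j) hL1]
  have hsBj0 : 0 ≤ sBj := by rw [hsBj]; positivity
  have hsB : sBj ≤ sBk := by
    rw [hsBj, hsBk]
    have : ((F.P K).d : ℝ) * (3 * ((F.P K).L : ℝ) ^ j - 1) ≤ ((F.P K).d : ℝ) * (3 * ((F.P K).L : ℝ) ^ (K - n) - 1) :=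
      mul_le_mul_of_nonneg_left (by linarith) hd0
    nlinarith [ha₀0.le]
  have hte0 : 0 ≤ η * e := by positivity
  have hxj : ((F.P K).L : ℝ) ^ j * (2 * (η * e) + 30 * ℓr * sBj) ≤ ((F.P K).L : ℝ) ^ (K - n) * (2 * (η * e) + 30 * ℓr * sBk) := by
    apply mul_le_mul hpow _ (by positivity) (by positivity)
    nlinarith [mul_le_mul_of_nonneg_left hsB (by positivity : (0 : ℝ) ≤ 30 * ℓr)]
  have hbud₀j : 6400 * ℓr ^ 2 * ((F.P K).L : ℝ) ^ j * sBj ≤ 1 := by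
    refine le_trans ?_ hbud₀
    have h1 : 6400 * ℓr ^ 2 * ((F.P K).L : ℝ) ^ j * sBj ≤ 6400 * ℓr ^ 2 * ((F.P K).L : ℝ) ^ (K - n) * sBj :=
      mul_le_mul_of_nonneg_right (mul_le_mul_of_nonneg_left hpow (by positivity)) hsBj0
    have h2 : 6400 * ℓr ^ 2 * ((F.P K).L : ℝ) ^ (K - n) * sBj ≤ 6400 * ℓr ^ 2 * ((F.P K).L : ℝ) ^ (K - n) * sBk :=
      mul_le_mul_of_nonneg_left hsB (by positivity)
    exact h1.trans h2
  have hbudj : 8 * (16 * (22100 : ℝ) + 2) * ℓr ^ 2 * (((F.P K).L : ℝ) ^ j * (2 * (η * e) + 30 * ℓr * sBj)) ≤ 1 := by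
    have hC : 0 ≤ 8 * (16 * (22100 : ℝ) + 2) * ℓr ^ 2 := by positivity
    refine (mul_le_mul_of_nonneg_left (hxj.trans hxX) hC).trans ?_
    rw [hℓ]; exact hWF
  -- the reads of the rescaled exponent `A″ = (iη)⁻¹A`: `‖ηA″(b)‖ ≤ ηe`
  have hA' : ∀ b, ‖(η : ℂ) • ((fun b => (Complex.I * (η : ℂ))⁻¹ • A b) b)‖ ≤ η * e := fun b =>
    norm_smul_eta_inv_le F hηne A (fun b => by rw [← hηeta]; exact hA b) b
  obtain ⟨hrel, hfs, hft⟩ := norm_dbarCovIterU_rel_frameAccU_le_of_plaqSmall (P := F.P K) (by norm_num : (2 : ℝ) ≤ 22100) (hstep_T3 F) (hframe_T3 F) hk1 U₀ ha₀0 hU η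
    (fun b => (Complex.I * (η : ℂ))⁻¹ • A b) ht1 hA' hbud₀j hbudj e'
  have hW : (fun b => expUnit (A b) * bgUnits F K U₀ b) = fun b => expCfg η (fun b => (Complex.I * (η : ℂ))⁻¹ • A b) b * unitsField (toUField U₀) b :=
    perturbedField_eq F K hηne U₀ A
  -- the geometric reading of the engine's bound: `L^j(2ηe + 30ℓ sB_j) ≤ (2e + 2700Lε₀)·(L^j η)`
  have hgeom : ((F.P K).L : ℝ) ^ j * (2 * (η * e) + 30 * ℓr * sBj) ≤ (2 * e + 2700 * (F.L : ℝ) * ε₀) * ((F.L : ℝ) ^ j * η) := by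
    rw [hLL]
    have hLjη : (F.L : ℝ) ^ j * η ≤ 1 := by rw [← hηeta]; exact pow_mul_eta_le_one F hj
    have hLjη0 : 0 ≤ (F.L : ℝ) ^ j * η := by positivity
    have hsBj_le : sBj ≤ 18 * (F.L : ℝ) ^ j * (ε₀ * η ^ 2) := by
      rw [hsBj, hd, hLL, ha₀η]; push_cast; nlinarith [pow_nonneg hL0.le j, mul_nonneg hε₀.le (sq_nonneg η)]
    have hℓ' : ℓr = 5 * (F.L : ℝ) := hℓ
    rw [hℓ']
    have h1 : (F.L : ℝ) ^ j * (30 * (5 * (F.L : ℝ)) * sBj) ≤ 2700 * (F.L : ℝ) * ε₀ * ((F.L : ℝ) ^ j * η) := by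
      calc (F.L : ℝ) ^ j * (30 * (5 * (F.L : ℝ)) * sBj) ≤ (F.L : ℝ) ^ j * (30 * (5 * (F.L : ℝ)) * (18 * (F.L : ℝ) ^ j * (ε₀ * η ^ 2))) := by
            gcongr
        _ = 2700 * (F.L : ℝ) * ε₀ * ((F.L : ℝ) ^ j * η) * ((F.L : ℝ) ^ j * η) := by ring
        _ ≤ 2700 * (F.L : ℝ) * ε₀ * ((F.L : ℝ) ^ j * η) * 1 := by gcongr
        _ = 2700 * (F.L : ℝ) * ε₀ * ((F.L : ℝ) ^ j * η) := by ring
    have h2 : (F.L : ℝ) ^ j * (2 * (η * e)) = 2 * e * ((F.L : ℝ) ^ j * η) := by ring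
    calc (F.L : ℝ) ^ j * (2 * (η * e) + 30 * (5 * (F.L : ℝ)) * sBj) = (F.L : ℝ) ^ j * (2 * (η * e)) + (F.L : ℝ) ^ j * (30 * (5 * (F.L : ℝ)) * sBj) := by ring
      _ ≤ 2 * e * ((F.L : ℝ) ^ j * η) + 2700 * (F.L : ℝ) * ε₀ * ((F.L : ℝ) ^ j * η) := by rw [h2]; exact add_le_add le_rfl h1
      _ = (2 * e + 2700 * (F.L : ℝ) * ε₀) * ((F.L : ℝ) ^ j * η) := by ring
  have hrel' : _ ≤ 3 * (((F.P K).L : ℝ) ^ j * (2 * (η * e) + 30 * ℓr * sBj)) := hrel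
  have hfs' : _ ≤ 6 * ℓr * (((F.P K).L : ℝ) ^ j * (2 * (η * e) + 30 * ℓr * sBj)) := hfs
  have hft' : _ ≤ 6 * ℓr * (((F.P K).L : ℝ) ^ j * (2 * (η * e) + 30 * ℓr * sBj)) := hft
  have hℓ' : ℓr = 5 * (F.L : ℝ) := hℓ
  have hfin1 : 3 * (((F.P K).L : ℝ) ^ j * (2 * (η * e) + 30 * ℓr * sBj)) ≤ 3 * (2 * e + 2700 * (F.L : ℝ) * ε₀) * ((F.L : ℝ) ^ j * eta F n K) := by
    rw [hηeta]
    calc 3 * (((F.P K).L : ℝ) ^ j * (2 * (η * e) + 30 * ℓr * sBj)) ≤ 3 * ((2 * e + 2700 * (F.L : ℝ) * ε₀) * ((F.L : ℝ) ^ j * η)) :=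
          mul_le_mul_of_nonneg_left hgeom (by norm_num)
      _ = 3 * (2 * e + 2700 * (F.L : ℝ) * ε₀) * ((F.L : ℝ) ^ j * η) := by ring
  have hfin2 : 6 * ℓr * (((F.P K).L : ℝ) ^ j * (2 * (η * e) + 30 * ℓr * sBj)) ≤ 6 * (5 * (F.L : ℝ)) * ((2 * e + 2700 * (F.L : ℝ) * ε₀) * ((F.L : ℝ) ^ j * eta F n K)) := by
    rw [hηeta, hℓ']
    exact mul_le_mul_of_nonneg_left (by rw [← hℓ']; exact hgeom) (by positivity)
  rw [hW, bgUnits_eq]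
  exact ⟨hrel'.trans hfin1, hfs'.trans hfin2, hft'.trans hfin2⟩

/-- ★★ **(R2t′-stairs) THE TWISTED STAIR TRANSPORTERS ARE GEOMETRICALLY CLOSE TO `1`**: for `U₀ ∈ 𝔘_k(ε₀)`, `‖A(b)‖ ≤ e·η`, `10⁹L²e ≤ 1`, `10¹²L³ε₀ ≤ 1`, every level `j < K − n`, coarse site
`y` and index `i`: `‖τ_j(y,i) − 1‖ ≤ 60L·(2e + 2700Lε₀)·(L^j·η)` for `τ_j = tstairU (Ū₀♭ʲ) (D̄_j) y i`, `D̄_j = dbarCovIterU j U₀♭ (e^{A}U₀♭)` — ★px6's ✓`norm_tstairU_sub_one_le_of_regPr` with the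
geometric bondwise row in place of the uniform one: the two towers are bondwise `r_j := 3(2e + 2700Lε₀)(L^jη)`-close relatively, hence `2r_j`-close absolutely with their inverses (the background
tower is `U1`-valued), and a stair has `≤ 5L` letters (✓`norm_tstairU_sub_one_le_of_rel`). [cite: Balaban1985Averaging, (58) p.27, (161)-(163) p.42; Balaban1985Variational, (2) p.278] -/
theorem norm_tstairU_sub_one_le_geom_of_regPr {ε₀ e : ℝ} (hε₀ : 0 < ε₀) (he : 0 ≤ e) (hWe : 10 ^ 9 * (F.L : ℝ) ^ 2 * e ≤ 1) (hWε : 10 ^ 12 * (F.L : ℝ) ^ 3 * ε₀ ≤ 1)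
    (U₀ : GaugeField (F.P K) 0 (Matrix.specialUnitaryGroup (Fin 2) ℂ)) (hreg : RegPr F n K ε₀ U₀)
    (A : PBond (F.P K) 0 → Matrix (Fin 2) (Fin 2) ℂ) (hA : ∀ b, ‖A b‖ ≤ e * eta F n K) {j : ℕ} (hj : j < K - n) (y : Site (F.P K) (j + 1)) (i : Idx (F.P K)) :
    ‖((tstairU (emlIterU j (bgUnits F K U₀)) (dbarCovIterU j (bgUnits F K U₀) (fun b => expUnit (A b) * bgUnits F K U₀ b)) y i : (Matrix (Fin 2) (Fin 2) ℂ)ˣ) :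
        Matrix (Fin 2) (Fin 2) ℂ) - 1‖ ≤ 60 * (F.L : ℝ) * ((2 * e + 2700 * (F.L : ℝ) * ε₀) * ((F.L : ℝ) ^ j * eta F n K)) := by
  have hd : (F.P K).d = 3 := T3Family.P_d F K
  have hLL : ((F.P K).L : ℝ) = F.L := rfl
  have hL3 : 3 ≤ F.L := by obtain ⟨a, ha⟩ := F.hL.1; have := F.hL.2; omega
  have hL1 : (1 : ℝ) ≤ F.L := by exact_mod_cast (show 1 ≤ F.L by omega)
  have hε7 : 10 ^ 7 * (F.L : ℝ) ^ 3 * ε₀ ≤ 1 := by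
    have h1 : (0 : ℝ) ≤ (F.L : ℝ) ^ 3 * ε₀ := by positivity
    nlinarith
  have hℓ : ((((F.P K).d + 2) * (F.P K).L : ℕ) : ℝ) = 5 * (F.L : ℝ) := by
    rw [hd, ← hLL]; push_cast; ring
  have hη : 0 < eta F n K := eta_pos F n K
  have hLjη : (F.L : ℝ) ^ j * eta F n K ≤ 1 := pow_mul_eta_le_one F hj.le
  have hLjη0 : 0 ≤ (F.L : ℝ) ^ j * eta F n K := by positivity
  -- numerics: `r := 3(2e + 2700Lε₀)(L^jη) ≤ r₀ := 3(2e + 2700Lε₀)`, `2ℓ(2r₀) ≤ 10⁻⁶`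
  set r₀ : ℝ := 3 * (2 * e + 2700 * (F.L : ℝ) * ε₀) with hr₀
  set r : ℝ := 3 * (2 * e + 2700 * (F.L : ℝ) * ε₀) * ((F.L : ℝ) ^ j * eta F n K) with hr
  have hr₀0 : 0 ≤ r₀ := by positivity
  have hr0 : 0 ≤ r := by positivity
  have hrr₀ : r ≤ r₀ := by
    calc r = r₀ * ((F.L : ℝ) ^ j * eta F n K) := by rw [hr, hr₀]
      _ ≤ r₀ * 1 := mul_le_mul_of_nonneg_left hLjη hr₀0
      _ = r₀ := mul_one _
  have he9 : 10 ^ 9 * ((F.L : ℝ) * e) ≤ 1 := by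
    have hL12 : (F.L : ℝ) ≤ (F.L : ℝ) ^ 2 := by nlinarith
    have : (F.L : ℝ) * e ≤ (F.L : ℝ) ^ 2 * e := mul_le_mul_of_nonneg_right hL12 he
    nlinarith
  have hLε : 10 ^ 12 * ((F.L : ℝ) ^ 2 * ε₀) ≤ 1 := by
    have : (F.L : ℝ) ^ 2 * ε₀ ≤ (F.L : ℝ) ^ 3 * ε₀ := mul_le_mul_of_nonneg_right (pow_le_pow_right₀ hL1 (by norm_num : 2 ≤ 3)) hε₀.le
    linarith
  have hnum₀ : 2 * ((((F.P K).d + 2) * (F.P K).L : ℕ) : ℝ) * (2 * r₀) ≤ 1 / 10 ^ 6 := by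
    rw [hℓ, hr₀]
    have e1 : 2 * (5 * (F.L : ℝ)) * (2 * (3 * (2 * e + 2700 * (F.L : ℝ) * ε₀))) = 120 * ((F.L : ℝ) * e) + 162000 * ((F.L : ℝ) ^ 2 * ε₀) := by ring
    rw [e1]; nlinarith
  have hr2 : r ≤ 1 / 2 := by
    have hℓ1 : (1 : ℝ) ≤ 2 * ((((F.P K).d + 2) * (F.P K).L : ℕ) : ℝ) := by rw [hℓ]; linarith
    nlinarith
  -- the background tower is `U1`-valued, the perturbed tower `r`-close to it relatively (geometric row)
  have hV : ∀ b : PBond (F.P K) j, emlIterU j (bgUnits F K U₀) b ∈ U1 (Matrix (Fin 2) (Fin 2) ℂ) :=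
    fun b => emlIterU_bgUnits_mem_U1_of_regPr F hε₀ hε7 hreg hj.le b
  have hrel : ∀ b : PBond (F.P K) j,
      ‖((dbarCovIterU j (bgUnits F K U₀) (fun b => expUnit (A b) * bgUnits F K U₀ b) b : (Matrix (Fin 2) (Fin 2) ℂ)ˣ) : Matrix (Fin 2) (Fin 2) ℂ) *
          (((emlIterU j (bgUnits F K U₀) b)⁻¹ : (Matrix (Fin 2) (Fin 2) ℂ)ˣ) : Matrix (Fin 2) (Fin 2) ℂ) - 1‖ ≤ r :=
    fun b => (norm_dbarCovIterU_rel_sub_one_le_geom_of_regPr F hε₀ he hWe hWε U₀ hreg A hA hj.le b).1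
  have h₁ : ∀ b : PBond (F.P K) j,
      ‖((dbarCovIterU j (bgUnits F K U₀) (fun b => expUnit (A b) * bgUnits F K U₀ b) b : (Matrix (Fin 2) (Fin 2) ℂ)ˣ) : Matrix (Fin 2) (Fin 2) ℂ) -
          ((emlIterU j (bgUnits F K U₀) b : (Matrix (Fin 2) (Fin 2) ℂ)ˣ) : Matrix (Fin 2) (Fin 2) ℂ)‖ ≤ 2 * r :=
    fun b => (norm_sub_le_of_rel (hV b) (hrel b)).trans (by linarith [hr0])
  have h₂ : ∀ b : PBond (F.P K) j,
      ‖(((dbarCovIterU j (bgUnits F K U₀) (fun b => expUnit (A b) * bgUnits F K U₀ b) b)⁻¹ : (Matrix (Fin 2) (Fin 2) ℂ)ˣ) : Matrix (Fin 2) (Fin 2) ℂ) -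
          (((emlIterU j (bgUnits F K U₀) b)⁻¹ : (Matrix (Fin 2) (Fin 2) ℂ)ˣ) : Matrix (Fin 2) (Fin 2) ℂ)‖ ≤ 2 * r :=
    fun b => norm_inv_sub_inv_le_of_rel (hV b) hr2 (hrel b)
  have hδ0 : 0 ≤ 2 * r := by positivity
  have hℓδ : 2 * ((((F.P K).d + 2) * (F.P K).L : ℕ) : ℝ) * (2 * r) ≤ 1 := by
    have hℓ0 : 0 ≤ 2 * ((((F.P K).d + 2) * (F.P K).L : ℕ) : ℝ) := by positivity
    exact ((mul_le_mul_of_nonneg_left (by linarith [hrr₀]) hℓ0).trans hnum₀).trans (by norm_num)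
  refine (norm_tstairU_sub_one_le_of_rel _ _ hδ0 hV h₁ h₂ hℓδ y i).trans (le_of_eq ?_)
  rw [hℓ, hr]; ring

end T3

end Summit.QuantumFields.YangMills.Theorems.Prop7SymAvgTwSym

end
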